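import Literature.Probability.LatticeModels.MedialInterfaceProofs
import Literature.Probability.Percolation.LatticeTraceGeometry
import Literature.Probability.Percolation.AnnulusCircuits
import Literature.Probability.RandomPlanarGeometry.PlanarDomains
import Literature.Probability.Percolation.BoxCrossingProofs
import Summits.CriticalPhenomena.CardyFormulaZ2.Theorems.CardySelfRefinementLagHandOffKernelCircuitContact
import Summits.CriticalPhenomena.CardyFormulaZ2.Theorems.CardySelfRefinementLagHandOffKernelCircuitsFail
import HarnessLib

/-!
# Contacts accumulate in any Jordan domain: stub `stub_kernel_contactsAccumulate` (K8) of line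
`hitting-tournament` for crux `LagHandOff` (stmt-CriticalPhenomena-10268)

The assembled universal lemma of seat c5's kernel analysis for critical bond percolation on
`δℤ²` in a discretised Jordan domain `D` (admissible discrete Dobrushin data `E` with
`E.Ω = D.carrier`, mesh `δ = E.δ > 0`, wired arc `A`).  Fix a lattice point `v` such that the
boundary curve `∂D` has a point within `(l₀ + 1) δ` of the mesh point `δ v` and a point farther
than `3√2 · l₀ 4^k · δ` from it, and such that no site of the discrete arc `B` lies in
`v + B(3 l₀ 4^k)`.  Then the event "there is an `ω°`-open path — `ω`-open edges of `Ω_δ` through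
sites off both discrete arcs — from the `(l₀ + 1) δ`-neighbourhood of `δ v` to distance
`> 3√2 · l₀ 4^k · δ` which carries NO reachable open contact edge into the discrete arc `A`" has
probability at most `(1 - c)^k`, where `c` is any constant with `c ≤ P_{1/2}(O(l))` for every
`l ≥ 1` (RSW circuit bound for Grimmett's annulus event `O(l)`), uniformly in the domain and in
the mesh.

Proof.  Set inclusion plus the two landed bricks.

* If `ω` lies in the event (witnesses `x`, `y`) and some annulus `v + A(l₀ 4^j)`, `j < k`,
  carries an open circuit around `v`, then `stub_kernel_circuitForcesContact` (K6,
  `CardySelfRefinementLagHandOffKernelCircuitContact.lean`) at scale `l = l₀ 4^j` — its side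
  conditions follow from `l₀ ≤ l ≤ l₀ 4^k` and the monotonicity of boxes — produces a reachable
  open contact edge into `A`, contradicting the defining clause of the event.  Hence the event
  is contained in `⋂_{j < k} (openCircuitAroundAt v (l₀ 4^j))ᶜ`.
* By monotonicity of the measure and `stub_kernel_circuitsFail_pow` (K7,
  `CardySelfRefinementLagHandOffKernelCircuitsFail.lean`) the latter has probability
  `≤ (1 - c)^k`.

Helpers live in the sub-namespace `KernelContactsAccumulate`.
-/

noncomputable section

open Set Metric MeasureTheory
open Literature.Probability.Percolation Literature.Probability.LatticeModels
open Literature.Probability.RandomPlanarGeometry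

namespace Summit.CriticalPhenomena.CardyFormulaZ2.Cruxes.LagHandOff.HittingTournament

namespace KernelContactsAccumulate

/-! ### Scale comparisons `l₀ ≤ l₀ 4^j ≤ l₀ 4^k` for `j < k` -/

/-- `l₀ 4^j` is a positive scale as soon as `l₀ ≥ 1`. -/
theorem one_le_scale {l₀ : ℕ} (hl₀ : 1 ≤ l₀) (j : ℕ) : 1 ≤ l₀ * 4 ^ j :=
  Nat.mul_pos hl₀ (Nat.pow_pos (by norm_num))

/-- `l₀ ≤ l₀ 4^j` (as real numbers). -/
theorem cast_le_cast_scale (l₀ j : ℕ) : (l₀ : ℝ) ≤ ((l₀ * 4 ^ j : ℕ) : ℝ) := by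
  exact_mod_cast Nat.le_mul_of_pos_right _ (Nat.pow_pos (by norm_num))

/-- `l₀ 4^j ≤ l₀ 4^k` for `j < k`. -/
theorem scale_le_scale {l₀ j k : ℕ} (hjk : j < k) : l₀ * 4 ^ j ≤ l₀ * 4 ^ k :=
  Nat.mul_le_mul_left _ (Nat.pow_le_pow_right (by norm_num) hjk.le)

/-- `3√2 · l₀ 4^j · δ ≤ 3√2 · l₀ 4^k · δ` for `j < k` and `δ > 0`. -/
theorem far_radius_mono {l₀ j k : ℕ} (hjk : j < k) {δ : ℝ} (hδ : 0 < δ) :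
    3 * Real.sqrt 2 * ((l₀ * 4 ^ j : ℕ) : ℝ) * δ ≤ 3 * Real.sqrt 2 * ((l₀ * 4 ^ k : ℕ) : ℝ) * δ := by
  have h : ((l₀ * 4 ^ j : ℕ) : ℝ) ≤ ((l₀ * 4 ^ k : ℕ) : ℝ) := by exact_mod_cast scale_le_scale hjk
  have h2 : (0 : ℝ) ≤ 3 * Real.sqrt 2 := by positivity
  exact mul_le_mul_of_nonneg_right (mul_le_mul_of_nonneg_left h h2) hδ.le

/-- `(l₀ + 1) δ ≤ (l₀ 4^j + 1) δ` for `δ > 0`. -/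
theorem near_radius_mono (l₀ j : ℕ) {δ : ℝ} (hδ : 0 < δ) :
    ((l₀ : ℝ) + 1) * δ ≤ (((l₀ * 4 ^ j : ℕ) : ℝ) + 1) * δ :=
  mul_le_mul_of_nonneg_right (by linarith [cast_le_cast_scale l₀ j]) hδ.le

/-- No `B`-site in `v + B(3 l₀ 4^k)` implies no `B`-site in `v + B(3 l₀ 4^j)` for `j < k`
(boxes increase with the radius). -/
theorem arcB_away_mono {S : Set (Site 2)} {v : Site 2} {l₀ j k : ℕ} (hjk : j < k)
    (hB : ∀ b ∈ S, b - v ∉ (box 2 (3 * (l₀ * 4 ^ k)) : Finset (Site 2))) :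
    ∀ b ∈ S, b - v ∉ (box 2 (3 * (l₀ * 4 ^ j)) : Finset (Site 2)) := fun b hb h =>
  hB b hb (box_mono 2 (Nat.mul_le_mul_left 3 (scale_le_scale hjk)) h)

/-! ### The set inclusion -/

/-- **Deterministic core.** In the setting of the statement, a configuration carrying an
`ω°`-open path from the `(l₀ + 1) δ`-neighbourhood of `δ v` to distance `> 3√2 · l₀ 4^k · δ`
without a reachable open contact edge into `A` has no open circuit around `v` in any of the
annuli `v + A(l₀ 4^j)`, `j < k` (by K6 `stub_kernel_circuitForcesContact` at scale `l₀ 4^j`). -/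
theorem noContact_subset_biInter_compl (D : JordanDomain) (E : DiscreteDobrushin)
    (hΩ : E.Ω = D.carrier) (hE : E.IsZdAdmissible) (hδ : 0 < E.δ) (v : Site 2) {l₀ : ℕ} (k : ℕ)
    (hl₀ : 1 ≤ l₀)
    (hnear : ∃ q ∈ frontier D.carrier, dist q (meshPoint E.δ v) < ((l₀ : ℝ) + 1) * E.δ)
    (hfar : ∃ q ∈ frontier D.carrier,
      3 * Real.sqrt 2 * (l₀ * 4 ^ k : ℕ) * E.δ < dist q (meshPoint E.δ v))
    (hB : ∀ b ∈ E.zdArcB, b - v ∉ (box 2 (3 * (l₀ * 4 ^ k)) : Finset (Site 2))) :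
    {ω | ∃ x y : Site 2, dist (meshPoint E.δ x) (meshPoint E.δ v) < ((l₀ : ℝ) + 1) * E.δ ∧
        3 * Real.sqrt 2 * (l₀ * 4 ^ k : ℕ) * E.δ < dist (meshPoint E.δ y) (meshPoint E.δ v) ∧
        (ω ∩ (discreteDomainGraph E.Ω E.δ).edgeSet) ∈
          openConnIn (meshDomain E.Ω E.δ \ (E.zdArcA ∪ E.zdArcB)) x y ∧
        ¬ ∃ u u' : Site 2, u' ∈ E.zdArcA ∧ u ∉ E.zdArcA ∪ E.zdArcB ∧ s(u, u') ∈ ω ∧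
          s(u, u') ∈ (discreteDomainGraph E.Ω E.δ).edgeSet ∧
          (ω ∩ (discreteDomainGraph E.Ω E.δ).edgeSet) ∈
            openConnIn (meshDomain E.Ω E.δ \ (E.zdArcA ∪ E.zdArcB)) x u} ⊆
      ⋂ j ∈ Finset.range k, (openCircuitAroundAt v (l₀ * 4 ^ j))ᶜ := by
  rintro ω ⟨x, y, hx, hy, hconn, hno⟩
  refine Set.mem_iInter₂.2 fun j hj hcirc => hno ?_
  have hjk : j < k := Finset.mem_range.1 hj
  obtain ⟨qn, hqn, hqnd⟩ := hnear
  obtain ⟨qf, hqf, hqfd⟩ := hfar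
  obtain ⟨u, u', hu'A, hu, hωu, hEu, -, hconnu⟩ :=
    stub_kernel_circuitForcesContact D E hΩ hE hδ ω v (l₀ * 4 ^ j) (one_le_scale hl₀ j) hcirc
      ⟨qn, hqn, hqnd.trans_le (near_radius_mono l₀ j hδ)⟩
      ⟨qf, hqf, (far_radius_mono hjk hδ).trans_lt hqfd⟩
      (arcB_away_mono hjk hB) x y (hx.trans_le (near_radius_mono l₀ j hδ))
      ((far_radius_mono hjk hδ).trans_lt hy) hconn
  exact ⟨u, u', hu'A, hu, hωu, hEu, hconnu⟩

end KernelContactsAccumulate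

open KernelContactsAccumulate in
/-- **K8 `stub_kernel_contactsAccumulate` — contacts accumulate in ANY Jordan domain.** For
critical bond percolation on `δℤ²` in a discretised Jordan domain with wired arc `A`, the event
that an `ω°`-open path (`ω`-open `Ω_δ`-edges through sites off both discrete arcs) runs from the
`(l₀ + 1) δ`-neighbourhood of a boundary-near lattice point `v` to distance `> 3√2 · l₀ 4^k · δ`
while carrying NO reachable open contact edge into the discrete arc `A` has probability
`≤ (1 - c)^k`, `c` the RSW circuit constant — uniformly in the domain and in the mesh.  The event
is contained in "no open circuit around `v` in any annulus `v + A(l₀ 4^j)`, `j < k`" (K6), whose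
probability is `≤ (1 - c)^k` (K7). -/
theorem stub_kernel_contactsAccumulate :
    ∀ (D : JordanDomain) (E : DiscreteDobrushin), E.Ω = D.carrier → E.IsZdAdmissible → 0 < E.δ →
      ∀ (c : ℝ), (∀ l : ℕ, 1 ≤ l → c ≤ (bondPercolation (zdGraph 2) half).real (openCircuitAround l)) →
      ∀ (v : Site 2) (l₀ k : ℕ), 1 ≤ l₀ →
      (∃ q ∈ frontier D.carrier, dist q (meshPoint E.δ v) < ((l₀ : ℝ) + 1) * E.δ) →
      (∃ q ∈ frontier D.carrier, 3 * Real.sqrt 2 * (l₀ * 4 ^ k : ℕ) * E.δ < dist q (meshPoint E.δ v)) →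
      (∀ b ∈ E.zdArcB, b - v ∉ (box 2 (3 * (l₀ * 4 ^ k)) : Finset (Site 2))) →
      (bondPercolation (zdGraph 2) half).real
          {ω | ∃ x y : Site 2, dist (meshPoint E.δ x) (meshPoint E.δ v) < ((l₀ : ℝ) + 1) * E.δ ∧
            3 * Real.sqrt 2 * (l₀ * 4 ^ k : ℕ) * E.δ < dist (meshPoint E.δ y) (meshPoint E.δ v) ∧
            (ω ∩ (discreteDomainGraph E.Ω E.δ).edgeSet) ∈
              openConnIn (meshDomain E.Ω E.δ \ (E.zdArcA ∪ E.zdArcB)) x y ∧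
            ¬ ∃ u u' : Site 2, u' ∈ E.zdArcA ∧ u ∉ E.zdArcA ∪ E.zdArcB ∧ s(u, u') ∈ ω ∧
              s(u, u') ∈ (discreteDomainGraph E.Ω E.δ).edgeSet ∧
              (ω ∩ (discreteDomainGraph E.Ω E.δ).edgeSet) ∈
                openConnIn (meshDomain E.Ω E.δ \ (E.zdArcA ∪ E.zdArcB)) x u} ≤ (1 - c) ^ k := by
  intro D E hΩ hE hδ c hc v l₀ k hl₀ hnear hfar hB
  exact (measureReal_mono (noContact_subset_biInter_compl D E hΩ hE hδ v k hl₀ hnear hfar hB)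
    (measure_ne_top _ _)).trans (stub_kernel_circuitsFail_pow c hc v l₀ k hl₀)

end Summit.CriticalPhenomena.CardyFormulaZ2.Cruxes.LagHandOff.HittingTournament

end
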